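import Summits.QuantumFields.YangMills.Theorems.FluctuationComparisonRegPrIntLOrganTangentDwhiteOfWhiteningKernel
import Literature.MathematicalPhysics.QuantumFieldTheory.Balaban1983to89.B13AccretiveOfRealCoercive
import HarnessLib

/-!
# Crux `FluctuationComparisonRegPrIntL` (stmt-QuantumFields-20520, rung R3), PATH-B organ (covariant organ of record, RULING №56) — (L57) «(W-acc) FROM REAL
# COERCIVITY AT THE CENTRE»: the complex-ball accretivity letter (W-acc) of px19 g23's ✓p827976 `whiteningKernel_rowSum∕mulVec_lip` and of ✓(L52)
# `dwhite_of_whiteningKernel` is STRUCK in favour of print's two inputs — (W-coer) «the REAL fluctuation operator at the real small background is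
# γ-coercive» ([Balaban1985BackgroundPropagators] Thm 3.11 p.416 ∕ p.428) and (W-maj) «the complexified family has an entrywise majorant with bounded
# absolute row and column sums» ([Balaban1988RG2Cluster] p.15 «The general case is handled by a perturbative argument»; [Balaban1985BackgroundPropagators]
# Thm 3.4 p.400, Sect. B (3.62)–(3.64) p.402) — BY NAME over lit ✓`B13AccretiveOfRealCoercive.accretive_ball_of_coercive_centre` (Schwarz lemma +
# ✓`B13RealSliceEntryLetters.accretive_of_coercive_sub`).

Cell `ym3-torus` (YM ladder rung R3 = continuum `SU(2)` Yang–Mills on the three-torus — a RUNG: NOT d = 4, NOT infinite volume, NOT a mass gap, NOT Clay).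
Width seat `ym-ust-20520-w5` (gen 27), `--kind proof --supports stmt-QuantumFields-20520 --as helper`, count-neutral, DEFINITION-FREE, default heartbeats,
no registry ∕ binder ∕ `Lines/` edit.  Over ✓p828894 (L52) `…OrganTangentDwhiteOfWhiteningKernel` (w5 g26), ✓p827976 `…OrganTangentWhiteningKernelLipOfLetters`
(px19 g23), lit ✓`B13AccretiveOfRealCoercive` (pub-ymgap N10 module 56A), lit ✓`B13RealSliceEntryLetters` (`RealStructure`, `realStructureComplex`, `lam`),
lit ✓`B13Sqrt27Accretive` (`invSqrt`), lit ✓`QGQInverse` (`Coercive`).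

THE POINT (UV3-NODE §92.2 L2-a).  ✓p827976 ∕ ✓(L52) carry, for the whitening-kernel family `u ↦ A u` (inhabitant: `u ↦ K_{V_u}`, the fluctuation
operator of the whitened covariant chart along the complexified one-bond move of the background), THREE letters: (W-holo) entrywise holomorphy on
`‖u‖ < R`, (W-acc) ONE accretivity margin `m > 0` of `A u` at EVERY COMPLEX `u` of the ball, (W-real) real-slice decay of `(A v)^{−1∕2}`.  (W-acc) as
lettered is «nobody's theorem and not a printed statement: print DERIVES it» (lit 56A header) — the REAL operator has a lower bound ([Balaban1985BackgroundPropagators]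
Thm 3.11 p.416 for `Δ_a, G`; p.428 «a positive definite operator C*Δ_kC with a lower bound γ₀ > 0 independent of k and U»), and the complex extension is a
SMALL PERTURBATION of it (Thm 3.4 p.400 «describing these analytic extensions as small perturbations of the operators depending on U only»; [Balaban1988RG2Cluster]
p.15).  This file executes that derivation for the organ's D0 whitening letters:

THE LETTERS AFTER (L57) (hypothesis texts; `V` a `θ_j`-small coarse field, `b` a coarse bond, `w` a unit direction, as in ✓(L52)):
* (W-holo) as before, on `‖u‖ < R`.
* (W-read0) «`A V b w 0 = (K V).map ofReal`» — at the centre the family READS the REAL fluctuation operator `K V : Matrix p p ℝ` of the chart (`b`, `w`-free).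
* (W-coer) «`Coercive (K V) γK` for every `θ_j`-small `V`», ONE `γK > 0` — [Balaban1985BackgroundPropagators] Thm 3.11 ∕ Thm 3.12 ∕ p.428 IN ITS PRINTED, REAL
  FORM; m-UNIFORM iff `γK` is: THIS is UV3-NODE §92.2 L2-a (the curved multi-level coercivity on the T³ record — MISSING in the tree; flat k-level
  ✓`B6QGGQCoerciveMultiLevelTorus`, curved one step ✓`B9Thm311SmallFieldCoercivity(Uniform∕Tower)` are its typed neighbours); NOT discharged here.
* (W-maj) «`‖A V b w u i j′‖ ≤ Mx i j′` on `‖u‖ < R`, with `Σ_{j′} Mx i j′ ≤ S`, `Σ_i Mx i j′ ≤ S`», ONE `(Mx, S)` for all `(V, b, w)` — locality + boundedness of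
  the complexified local operators ([Balaban1985BackgroundPropagators] (3.23)–(3.26), Thm 3.4 p.400; [Balaban1988RG2Cluster] p.15); trivially m-uniform for a
  finite-range operator with bounded coefficients.
* the thin radius `0 < R₁ ≤ R` with `2S·R₁∕R ≤ γK∕2` ([Balaban1988RG2Cluster] p.15: the analyticity domain «much bigger» than the real neighbourhood used);
  (W-real) on `‖v‖ < R₁`; (W-read), (z-window∣MW), `hkW` as in ✓(L52) with the constants read at `(m, R) := (γK∕2, R₁)`; guard `δ₀ < (r∕(1+r))·R₁∕2`.

WHAT (sorry-free, def-free).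
* §0 ★`accretive_half_of_coerciveCentre` — lit ✓`accretive_ball_of_coercive_centre` read at the thin radius: (W-holo) + (W-maj) + `A 0 = T₀` real
  `γ`-coercive + `2S·R₁∕R ≤ γ∕2` ⟹ `A u` is `(γ∕2)`-accretive on `‖u‖ < R₁` — EXACTLY the `hacc` TEXT of ✓`whiteningKernel_mulVec_lip` at `(m, R) := (γ∕2, R₁)`.
* §1 ★★`whiteningKernel_rowSum_lip_of_coerciveCentre`, ★★`whiteningKernel_mulVec_lip_of_coerciveCentre` — ✓p827976 §4's two theorems with the binders
  `(hm, hacc)` DELETED and `(hMx, hrow, hcol, hS, h0, hc, hγ, hR₁, hR₁R, hsmall)` in their place; conclusions = ✓p827976's shapes at `(m, R) := (γ∕2, R₁)`.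
* §2 ★★★`dwhite_of_whiteningKernel_coerciveCentre` — ✓(L52) `dwhite_of_whiteningKernel` with the binder `hacc` DELETED and `(K, hK0, γK, hγK, hcoer)` +
  `(Mx, S, hS, hrow, hcol, hMx)` + `(R₁, hR₁, hR₁R, hsmall)` in its place; CONCLUSION = ✓(L52)'s = ✓`dlinkPath∕Square_of_dmin_dwhite`'s `hDwhite` binder text
  VERBATIM (so `dlinkPath_of_dmin_dwhite … hDmin (dwhite_of_whiteningKernel_coerciveCentre …)` type-checks by name).  Proof: ✓(L52) ∘ §0, per `(V, b, w)`.
SAME FAMILY (LEAD №69's check): (W-holo), (W-maj), (W-read0)∕the centre `A 0` and (W-real) all quantify THE SAME family `A` — in §0∕§1 one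
`A : E → Matrix p p ℂ` on `ball 0 R` (✓p827976's binder), in §2 ✓(L52)'s `A V b w : ℂ → Matrix p p ℂ` with its `(V, b, w)` indexing and guards
(`PlaqSmall (θBal …) V → ‖w‖ ≤ 1 →`) on `ball (0:ℂ) R` — so §1∕§2 are PURE HYPOTHESIS SWAPS of ✓p827976 §4 ∕ ✓(L52); the only displayed constants that
move are `(m, R) ↦ (γ∕2, R₁)` (✓p827976 ∕ ✓(L52) are CALLED at the thin radius `R₁ ≤ R`, where the margin holds; holomorphy restricts by `mono`).
NET: D0's whitening letter list reads {(W-holo), (W-read0) + (W-coer) REAL = L2-a AS PRINTED, (W-maj), (W-real) = L2-b, (W-read), (z-window∣MW)}; the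
complex-ball margin is no longer a letter of the organ.
INHABITATION (★★OWNER RULING №100): LAW-FREE — statements about the chart objects `A`, `K`, `Wh`, `coord` pointwise; no fibre law, no score, no cross-law object.

HONEST FRAMING: a door between HYPOTHESIS letters, by [folklore] complex analysis already kernel-checked in lit (Schwarz lemma road); (W-coer) — the
curved multi-level REAL coercivity of the actual `K_V` on the T³ record — (W-maj), (W-holo), (W-real), (W-read0), (W-read), (z-window∣MW) are D0's content
(crux 19200 EX ∧ V2′; [Balaban1985BackgroundPropagators] §3) and are NOT proved here; (Dmin), (χ-Lip∣MW), (I-curv), (I-cov), KER′ letters, rows v0.1–v0.4ᴱ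
UNDISCHARGED; nothing of Bałaban's analysis is asserted or proved; the five registered stubs of `Lines/semiclassical_s2beta.lean`, crux 20520 and
`YM3TorusSU2` are NOT proved; registry untouched; rung R3 = SU(2) YM₃ on T³ — NOT d = 4, NOT infinite volume, NOT a mass gap, NOT Clay; the Yang–Mills
mass gap is NOT proved.  [folklore]

References: T. Bałaban, CMP **99** (1985) 389–434 [Balaban1985BackgroundPropagators] (Thm 3.4 p.400, (3.62)–(3.64) p.402, Thm 3.10 (3.108) p.416, Thm 3.11
p.416, Thm 3.12 p.423, p.428); CMP **116** (1988) 1–22 [Balaban1988RG2Cluster] ((2.7) p.13, p.15, (2.16) p.16).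
-/

set_option autoImplicit false

noncomputable section

namespace Summit.QuantumFields.YangMills.Theorems.OrganTangentDwhiteOfRealCoercive

open Function Set Metric Finset
open scoped NNReal Matrix
open Literature.MathematicalPhysics.QuantumFieldTheory
open Literature.MathematicalPhysics.QuantumFieldTheory.Balaban1983to89 T3ContinuumYM3Torus T3NestedUnitLaws
  T3UnitLawDensityEML T4Continuum BalabanUVClass T3UnitScaleTilt T3LevelShift T3TiltDescent
open T4CubeChartExp (expPt)
open Literature.MathematicalPhysics.QuantumFieldTheory.Balaban1983to89.B9Thm37GlueTorus (tdist1)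
open Literature.MathematicalPhysics.QuantumFieldTheory.Balaban1983to89.B5TorusCover (UT)
open Literature.MathematicalPhysics.QuantumFieldTheory.Balaban1983to89.B13Sqrt27Accretive (invSqrt)
open Literature.MathematicalPhysics.QuantumFieldTheory.Balaban1983to89.B13RealSliceEntryLetters (RealStructure realStructureComplex lam)
open Literature.MathematicalPhysics.QuantumFieldTheory.Balaban1983to89.B13AccretiveOfRealCoercive (accretive_ball_of_coercive_centre)
open Literature.MathematicalPhysics.QuantumFieldTheory.Balaban1983to89.QGQInverse (Coercive)
open Summit.QuantumFields.YangMills.Theorems.OrganTangentWhiteningKernelLipOfLetters (whiteningKernel_rowSum_lip whiteningKernel_mulVec_lip)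
open Summit.QuantumFields.YangMills.Theorems.OrganTangentDwhiteOfWhiteningKernel (dwhite_of_whiteningKernel)

/-! ## §0 The half margin on the thin ball (lit 56A read at `R₁`) -/

section Generic

variable {E : Type*} [NormedAddCommGroup E] [NormedSpace ℂ E]
variable {p : Type} [Fintype p]

/-- ★ **THE `γ∕2` MARGIN ON THE THIN BALL** — lit ✓`accretive_ball_of_coercive_centre` read at the thin radius: `A : E → Matrix p p ℂ` entrywise holomorphic
on `‖u‖ < R` with a majorant `‖A u i j‖ ≤ Mx i j` there of absolute row and column sums `≤ S`, `A 0 = T₀` REAL and `γ`-coercive, `0 < R₁ ≤ R`,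
`2S·R₁∕R ≤ γ∕2` ⟹ `(γ∕2)·Σ‖w i‖² ≤ Re Σ w̄ᵢ (A u w)ᵢ` for every `‖u‖ < R₁` — EXACTLY the `hacc` TEXT of ✓`whiteningKernel_mulVec_lip` at `(m, R) := (γ∕2, R₁)`.
[cite: Balaban1985BackgroundPropagators, Thm 3.4 p.400, (3.62)-(3.64) p.402, p.428; Balaban1988RG2Cluster, p.15, (2.16) p.16] -/
theorem accretive_half_of_coerciveCentre {A : E → Matrix p p ℂ} {R R₁ S γ : ℝ} {Mx : p → p → ℝ} {T₀ : Matrix p p ℝ}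
    (hA : ∀ i j, DifferentiableOn ℂ (fun u => A u i j) (ball (0 : E) R))
    (hMx : ∀ u ∈ ball (0 : E) R, ∀ i j, ‖A u i j‖ ≤ Mx i j)
    (hrow : ∀ i, ∑ j, Mx i j ≤ S) (hcol : ∀ j, ∑ i, Mx i j ≤ S) (hS : 0 ≤ S)
    (h0 : A 0 = T₀.map (algebraMap ℝ ℂ)) (hc : Coercive T₀ γ)
    (hR₁ : 0 < R₁) (hR₁R : R₁ ≤ R) (hsmall : 2 * S * R₁ / R ≤ γ / 2) :
    ∀ u ∈ ball (0 : E) R₁, ∀ w : p → ℂ, γ / 2 * ∑ i, ‖w i‖ ^ 2 ≤ (∑ i, star (w i) * (A u *ᵥ w) i).re := by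
  intro u hu w
  have h := accretive_ball_of_coercive_centre hA hMx hrow hcol hS h0 hc hR₁.le hR₁R u hu w
  have hsum : 0 ≤ ∑ i, ‖w i‖ ^ 2 := sum_nonneg fun i _ => by positivity
  have hle : γ / 2 ≤ γ - 2 * S * R₁ / R := by linarith
  exact (mul_le_mul_of_nonneg_right hle hsum).trans h

/-! ## §1 The whitening kernel's background-Lipschitz bounds with (W-acc) struck -/

variable {ν : ℕ} {Nf : Fin ν → ℕ} [∀ i, NeZero (Nf i)]
variable [DecidableEq p]

/-- ★★ **ROW-SUM LIPSCHITZ OF THE WHITENING KERNEL FROM A REAL COERCIVE CENTRE** — ✓`whiteningKernel_rowSum_lip` with `(hm, hacc)` DELETED and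
(W-maj) `(hMx, hrow, hcol, hS)` + the centre `(h0, hc, hγ)` + the thin radius `(hR₁, hR₁R, hsmall)` in their place; (W-real) on `‖v‖ < R₁`; conclusion =
✓`whiteningKernel_rowSum_lip`'s at `(m, R) := (γ∕2, R₁)`: on `‖u‖, ‖u′‖ < (r∕(1+r))·R₁∕2`,
`Σ_j ‖invSqrt (A u′) i j − invSqrt (A u) i j‖ ≤ (4∕R′)·(Σ_j B′·e^{−ρ′ d(i,j)})·‖u′ − u‖`, `R′ = (r∕(1+r))R₁`, `B′ = B^{1−λ(r)}(max B (2∕√(γ∕2)))^{λ(r)}`, `ρ′ = (1−λ(r))ρ`.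
[cite: Balaban1988RG2Cluster, (2.7) p.13, p.15; Balaban1985BackgroundPropagators, Thm 3.4 p.400, Thm 3.10 (3.108) p.416, Thm 3.11 p.416, p.428] -/
theorem whiteningKernel_rowSum_lip_of_coerciveCentre (ℛ : RealStructure E) {A : E → Matrix p p ℂ} {loc : p → UT Nf}
    {R R₁ S γ ρ B r : ℝ} {Mx : p → p → ℝ} {T₀ : Matrix p p ℝ}
    (hA : ∀ i j, DifferentiableOn ℂ (fun u => A u i j) (ball (0 : E) R))
    (hMx : ∀ u ∈ ball (0 : E) R, ∀ i j, ‖A u i j‖ ≤ Mx i j)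
    (hrow : ∀ i, ∑ j, Mx i j ≤ S) (hcol : ∀ j, ∑ i, Mx i j ≤ S) (hS : 0 ≤ S)
    (h0 : A 0 = T₀.map (algebraMap ℝ ℂ)) (hc : Coercive T₀ γ) (hγ : 0 < γ)
    (hR₁ : 0 < R₁) (hR₁R : R₁ ≤ R) (hsmall : 2 * S * R₁ / R ≤ γ / 2)
    (hreal : ∀ v ∈ ℛ.Ereal, ‖v‖ < R₁ → ∀ i j,
      ‖invSqrt (A v) i j‖ ≤ B * Real.exp (-(ρ * tdist1 Nf (loc i) (loc j))))
    (hB0 : 0 ≤ B) (hρ : 0 ≤ ρ) (hr0 : 0 < r) (hr1 : r < 1)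
    {u u' : E} (hu : ‖u‖ < r / (1 + r) * R₁ / 2) (hu' : ‖u'‖ < r / (1 + r) * R₁ / 2) (i : p) :
    ∑ j, ‖invSqrt (A u') i j - invSqrt (A u) i j‖
      ≤ (4 / (r / (1 + r) * R₁)) *
          (∑ j, (B ^ (1 - lam r) * (max B (2 / Real.sqrt (γ / 2))) ^ lam r) *
            Real.exp (-((1 - lam r) * ρ * tdist1 Nf (loc i) (loc j)))) * ‖u' - u‖ :=
  whiteningKernel_rowSum_lip ℛ hR₁ (half_pos hγ) (fun i j => (hA i j).mono (ball_subset_ball hR₁R))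
    (accretive_half_of_coerciveCentre hA hMx hrow hcol hS h0 hc hR₁ hR₁R hsmall) hreal hB0 hρ hr0 hr1 hu hu' i

/-- ★★ **MATRIX–VECTOR LIPSCHITZ OF THE WHITENING KERNEL FROM A REAL COERCIVE CENTRE** ((Dwhite)'s letter shape) — ✓`whiteningKernel_mulVec_lip` with
`(hm, hacc)` DELETED and `(hMx, hrow, hcol, hS, h0, hc, hγ, hR₁, hR₁R, hsmall)` in their place; (W-real) on `‖v‖ < R₁`; conclusion = ✓`whiteningKernel_mulVec_lip`'s
at `(m, R) := (γ∕2, R₁)`: for `‖z j‖ ≤ Z`, `‖((invSqrt (A u′) − invSqrt (A u)) *ᵥ z) i‖ ≤ (4∕R′)·(Σ_j B′·e^{−ρ′ d(i,j)})·Z·‖u′ − u‖`.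
[cite: Balaban1988RG2Cluster, (2.7) p.13, p.15; Balaban1985BackgroundPropagators, Thm 3.4 p.400, Thm 3.10 (3.108) p.416, Thm 3.11 p.416, p.428] -/
theorem whiteningKernel_mulVec_lip_of_coerciveCentre (ℛ : RealStructure E) {A : E → Matrix p p ℂ} {loc : p → UT Nf}
    {R R₁ S γ ρ B r : ℝ} {Mx : p → p → ℝ} {T₀ : Matrix p p ℝ}
    (hA : ∀ i j, DifferentiableOn ℂ (fun u => A u i j) (ball (0 : E) R))
    (hMx : ∀ u ∈ ball (0 : E) R, ∀ i j, ‖A u i j‖ ≤ Mx i j)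
    (hrow : ∀ i, ∑ j, Mx i j ≤ S) (hcol : ∀ j, ∑ i, Mx i j ≤ S) (hS : 0 ≤ S)
    (h0 : A 0 = T₀.map (algebraMap ℝ ℂ)) (hc : Coercive T₀ γ) (hγ : 0 < γ)
    (hR₁ : 0 < R₁) (hR₁R : R₁ ≤ R) (hsmall : 2 * S * R₁ / R ≤ γ / 2)
    (hreal : ∀ v ∈ ℛ.Ereal, ‖v‖ < R₁ → ∀ i j,
      ‖invSqrt (A v) i j‖ ≤ B * Real.exp (-(ρ * tdist1 Nf (loc i) (loc j))))
    (hB0 : 0 ≤ B) (hρ : 0 ≤ ρ) (hr0 : 0 < r) (hr1 : r < 1)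
    {u u' : E} (hu : ‖u‖ < r / (1 + r) * R₁ / 2) (hu' : ‖u'‖ < r / (1 + r) * R₁ / 2)
    {z : p → ℂ} {Z : ℝ} (hZ : 0 ≤ Z) (hz : ∀ j, ‖z j‖ ≤ Z) (i : p) :
    ‖((invSqrt (A u') - invSqrt (A u)) *ᵥ z) i‖
      ≤ (4 / (r / (1 + r) * R₁)) *
          (∑ j, (B ^ (1 - lam r) * (max B (2 / Real.sqrt (γ / 2))) ^ lam r) *
            Real.exp (-((1 - lam r) * ρ * tdist1 Nf (loc i) (loc j)))) * Z * ‖u' - u‖ :=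
  whiteningKernel_mulVec_lip ℛ hR₁ (half_pos hγ) (fun i j => (hA i j).mono (ball_subset_ball hR₁R))
    (accretive_half_of_coerciveCentre hA hMx hrow hcol hS h0 hc hR₁ hR₁R hsmall) hreal hB0 hρ hr0 hr1 hu hu' hZ hz i

end Generic

/-! ## §2 (Dwhite∣MW) docked on the whitening kernel, (W-acc) struck: real coercivity at the centre + a majorant -/

section Dock

variable {ν : ℕ} {Nf : Fin ν → ℕ} [∀ i, NeZero (Nf i)]
variable {p : Type} [Fintype p] [DecidableEq p]

/-- ★★★ **(Dwhite∣MW) FROM REAL COERCIVITY AT THE CENTRE** — ✓(L52) `dwhite_of_whiteningKernel` with the binder `hacc` ((W-acc): one accretivity margin of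
the complexified family on the whole complex ball) DELETED and, in its place: the REAL fluctuation operator `K V` read at the centre (W-read0) `hK0`, its REAL
coercivity (W-coer) `hcoer : Coercive (K V) γK` for `θ_j`-small `V` ([Balaban1985BackgroundPropagators] Thm 3.11 ∕ p.428 — UV3-NODE §92.2 L2-a as printed),
the uniform majorant (W-maj) `(Mx, S)` of the complexified family ([Balaban1988RG2Cluster] p.15), and the thin radius `R₁` (`2S·R₁∕R ≤ γK∕2`); (W-real) on
`‖v‖ < R₁`; (W-holo), (W-read), (z-window∣MW) VERBATIM; `hkW` at `(m, R) := (γK∕2, R₁)`; guard `δ₀ < (r∕(1+r))·R₁∕2`.  CONCLUSION = ✓(L52)'s =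
✓`dlinkPath_of_dmin_dwhite` ∕ ✓`dlinkSquare_of_dmin_dwhite`'s `hDwhite` binder text VERBATIM.  Proof: ✓(L52) at `(m, R) := (γK∕2, R₁)` ∘ §0 per `(V, b, w)`.
[cite: Balaban1985BackgroundPropagators, Thm 3.4 p.400, (3.62)-(3.64) p.402, Thm 3.10 (3.108) p.416, Thm 3.11 p.416, p.428; Balaban1988RG2Cluster, (2.7) p.13, p.15] -/
theorem dwhite_of_whiteningKernel_coerciveCentre (F : T3Family) (γ b₀ p₀ : ℝ) (j Ts : ℕ) {Z : Type}
    (Φ : GaugeField (F.P j) 0 ↥(Matrix.specialUnitaryGroup (Fin 2) ℂ) × Z → GaugeField (F.P Ts) 0 ↥(Matrix.specialUnitaryGroup (Fin 2) ℂ))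
    (Wh : GaugeField (F.P j) 0 ↥(Matrix.specialUnitaryGroup (Fin 2) ℂ) → Z → PBond (F.P Ts) 0 → (Fin 3 → ℝ))
    (loc : p → UT Nf) (idx : PBond (F.P Ts) 0 → Fin 3 → p) (coord : Z → p → ℂ)
    -- (W-fam): the whitening-kernel family along unit-direction one-bond moves of the background, complexified
    (A : GaugeField (F.P j) 0 ↥(Matrix.specialUnitaryGroup (Fin 2) ℂ) → PBond (F.P j) 0 → (Fin 3 → ℝ) → ℂ → Matrix p p ℂ)
    -- (W-read0) + (W-coer): the REAL fluctuation operator of the chart, read at the centre of the family, γK-coercive at every `θ_j`-small background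
    (K : GaugeField (F.P j) 0 ↥(Matrix.specialUnitaryGroup (Fin 2) ℂ) → Matrix p p ℝ) (γK : ℝ) (hγK : 0 < γK)
    (hK0 : ∀ (V : GaugeField (F.P j) 0 ↥(Matrix.specialUnitaryGroup (Fin 2) ℂ)) (b : PBond (F.P j) 0) (w : Fin 3 → ℝ), PlaqSmall (θBal F.L γ b₀ p₀ j) V → ‖w‖ ≤ 1 →
      A V b w 0 = (K V).map (algebraMap ℝ ℂ))
    (hcoer : ∀ (V : GaugeField (F.P j) 0 ↥(Matrix.specialUnitaryGroup (Fin 2) ℂ)), PlaqSmall (θBal F.L γ b₀ p₀ j) V → Coercive (K V) γK)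
    -- (W-maj): one entrywise majorant of the complexified family with absolute row and column sums ≤ S
    (Mx : p → p → ℝ) (S : ℝ) (hS : 0 ≤ S) (hrow : ∀ i, ∑ j', Mx i j' ≤ S) (hcol : ∀ j', ∑ i, Mx i j' ≤ S)
    (R R₁ ρ B r δ₀ Zw : ℝ) (hR₁ : 0 < R₁) (hR₁R : R₁ ≤ R) (hsmall : 2 * S * R₁ / R ≤ γK / 2)
    (hB0 : 0 ≤ B) (hρ : 0 ≤ ρ) (hr0 : 0 < r) (hr1 : r < 1) (hZw : 0 ≤ Zw)
    (hδ₀R : δ₀ < r / (1 + r) * R₁ / 2)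
    -- (W-holo) on `‖u‖ < R`, (W-maj) on `‖u‖ < R`, (W-real) on `‖v‖ < R₁`: for every `θ_j`-small `V`, bond `b`, direction `‖w‖ ≤ 1`
    (hA : ∀ (V : GaugeField (F.P j) 0 ↥(Matrix.specialUnitaryGroup (Fin 2) ℂ)) (b : PBond (F.P j) 0) (w : Fin 3 → ℝ), PlaqSmall (θBal F.L γ b₀ p₀ j) V → ‖w‖ ≤ 1 →
      ∀ i j', DifferentiableOn ℂ (fun u => A V b w u i j') (ball (0 : ℂ) R))
    (hMx : ∀ (V : GaugeField (F.P j) 0 ↥(Matrix.specialUnitaryGroup (Fin 2) ℂ)) (b : PBond (F.P j) 0) (w : Fin 3 → ℝ), PlaqSmall (θBal F.L γ b₀ p₀ j) V → ‖w‖ ≤ 1 →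
      ∀ u ∈ ball (0 : ℂ) R, ∀ i j', ‖A V b w u i j'‖ ≤ Mx i j')
    (hreal : ∀ (V : GaugeField (F.P j) 0 ↥(Matrix.specialUnitaryGroup (Fin 2) ℂ)) (b : PBond (F.P j) 0) (w : Fin 3 → ℝ), PlaqSmall (θBal F.L γ b₀ p₀ j) V → ‖w‖ ≤ 1 →
      ∀ v ∈ realStructureComplex.Ereal, ‖v‖ < R₁ → ∀ i j', ‖invSqrt (A V b w v) i j'‖ ≤ B * Real.exp (-(ρ * tdist1 Nf (loc i) (loc j'))))
    -- (W-read): the organ's `Wh` READ through the family on real parameters (at `s = 0` it reads `Wh V z` itself)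
    (hread : ∀ (V : GaugeField (F.P j) 0 ↥(Matrix.specialUnitaryGroup (Fin 2) ℂ)) (b : PBond (F.P j) 0) (w : Fin 3 → ℝ) (s : ℝ), PlaqSmall (θBal F.L γ b₀ p₀ j) V → ‖w‖ ≤ 1 →
      |s| ≤ δ₀ → PlaqSmall (θBal F.L γ b₀ p₀ j) (update V b (V b * expPt (s • w))) →
      ∀ (z : Z) (e : PBond (F.P Ts) 0) (k : Fin 3), Wh (update V b (V b * expPt (s • w))) z e k = ((invSqrt (A V b w (s : ℂ)) *ᵥ coord z) (idx e k)).re)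
    -- (z-window∣MW): on the multiwindow-good open segment the fibre coordinates are window-bounded
    (hwin : ∀ (z : Z) (V : GaugeField (F.P j) 0 ↥(Matrix.specialUnitaryGroup (Fin 2) ℂ)) (b : PBond (F.P j) 0) (u : Fin 3 → ℝ), PlaqSmall (θBal F.L γ b₀ p₀ j) V →
      PlaqSmall (θBal F.L γ b₀ p₀ j) (update V b (V b * expPt u)) → ‖u‖ ≤ δ₀ →
      (∀ r ∈ Set.Ioo (0:ℝ) 1, ∀ (n : ℕ) (hjn : j + 1 ≤ n) (hnK : n ≤ Ts), PlaqSmall (24 / 25 * θBal F.L γ b₀ p₀ n) (descendTo F ℰp n Ts hnK (Φ (update V b (V b * expPt (r • u)), z)))) →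
      ∀ j', ‖coord z j'‖ ≤ Zw)
    -- the consumer's modulus dominates the row-sum shape at `(m, R) := (γK∕2, R₁)`, colour by colour
    (kW : PBond (F.P Ts) 0 → ℝ)
    (hkW : ∀ e k, (4 / (r / (1 + r) * R₁)) *
          (∑ j', (B ^ (1 - lam r) * (max B (2 / Real.sqrt (γK / 2))) ^ lam r) * Real.exp (-((1 - lam r) * ρ * tdist1 Nf (loc (idx e k)) (loc j')))) * Zw ≤ kW e) :
    ∀ (z : Z) (V : GaugeField (F.P j) 0 ↥(Matrix.specialUnitaryGroup (Fin 2) ℂ)) (b : PBond (F.P j) 0) (u : Fin 3 → ℝ), PlaqSmall (θBal F.L γ b₀ p₀ j) V →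
      PlaqSmall (θBal F.L γ b₀ p₀ j) (update V b (V b * expPt u)) → ‖u‖ ≤ δ₀ →
      (∀ r ∈ Set.Ioo (0:ℝ) 1, ∀ (n : ℕ) (hjn : j + 1 ≤ n) (hnK : n ≤ Ts), PlaqSmall (24 / 25 * θBal F.L γ b₀ p₀ n) (descendTo F ℰp n Ts hnK (Φ (update V b (V b * expPt (r • u)), z)))) →
      ∀ e, ‖Wh (update V b (V b * expPt u)) z e - Wh V z e‖ ≤ kW e * ‖u‖ :=
  dwhite_of_whiteningKernel F γ b₀ p₀ j Ts Φ Wh loc idx coord A R₁ (γK / 2) ρ B r δ₀ Zw hR₁ (half_pos hγK) hB0 hρ hr0 hr1 hZw hδ₀R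
    (fun V b w hV hw i j' => (hA V b w hV hw i j').mono (ball_subset_ball hR₁R))
    (fun V b w hV hw => accretive_half_of_coerciveCentre (hA V b w hV hw) (hMx V b w hV hw) hrow hcol hS (hK0 V b w hV hw) (hcoer V hV)
      hR₁ hR₁R hsmall)
    hreal hread hwin kW hkW

end Dock

end Summit.QuantumFields.YangMills.Theorems.OrganTangentDwhiteOfRealCoercive

end
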